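import Mathlib
import Summits.MatrixMultiplication.MatrixMultiplication.Theorems.SnSubsetDichotomyHyperoctahedralThresholdStubGoodTwin

/-!
# The same-colour supply, I: counting `c`-darts and their collisions
(crux `SnSubsetDichotomy.HyperoctahedralThreshold`, stmt-MatrixMultiplication-10883, line `refutation-local-symmetry`;
`--supports` helpers for the open stub `stub_poorRigidCore`; crux NOTES §15.1 (15.1), the SUPPLY half of the
supply/tip dichotomy — first file)

Vocabulary of the line: `μ 0, μ 1, μ 2` are involutions of `Fin n`; a colour word `g : List (Fin 3)` acts on the
right, `x · g := g.foldl (fun v d => μ d v) x`.  Words of length `k` are written as the `Finset`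
`(univ : Finset (List.Vector (Fin 3) k)).image toList`; the **reduced continuations** of the letter `c` are the `g`
with `List.IsChain (· ≠ ·) (c :: g)` (`g` reduced, not starting with `c`); there are exactly `2 ^ k` of them
(`card_cont`).

`coll_lower` (Cauchy–Schwarz / pigeonhole on the `c`-darts): the `n · 2^k` data (`a`, reduced continuation `g` of
`c` of length `k`) are mapped to `(a · g, (μ c a) · g) ∈ Fin n × Fin n`; by Cauchy–Schwarz
(`sq_sum_le_card_mul_sum_sq`) at least `4^k − n·2^k` ordered pairs of DISTINCT data collide, and a colliding pair
`((a, g), (a', g'))` is recorded injectively as the triple `(a, g, g')`, which has `g ≠ g'` and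
`(μ c a) · (g g'ʳ) = μ c (a · (g g'ʳ))` — a same-colour loop-to-loop structure read before reduction.  Hence
`4^k ≤ n·2^k + #{such triples}`.  The companion file `…SameColourSupply` strips common suffixes and turns this
into the multi-scale supply inequality (15.1) for genuine (reduced) structures.

Pure finite combinatorics; hypothesis only `μ d * μ d = 1`.  No definitions are introduced.
-/

set_option linter.dupNamespace false

namespace Summit.MatrixMultiplication.MatrixMultiplication.Theorems.HyperoctahedralThreshold.SameColourSupply

open GoodTwin

variable {n : ℕ}

/-- An involution undoes itself pointwise. -/
theorem act_invol (μ : Fin 3 → Equiv.Perm (Fin n)) (hμ : ∀ d, μ d * μ d = 1) (c : Fin 3) (x : Fin n) :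
    μ c (μ c x) = x := by
  have : (μ c * μ c) x = x := by rw [hμ c]; rfl
  simpa using this

/-- Walking back along the reversed word undoes the walk (letters are involutions). [folklore] -/
theorem foldl_act_reverse (μ : Fin 3 → Equiv.Perm (Fin n)) (hμ : ∀ d, μ d * μ d = 1) :
    ∀ (w : List (Fin 3)) (x : Fin n),
      w.reverse.foldl (fun v d => μ d v) (w.foldl (fun v d => μ d v) x) = x := by
  intro w
  induction w with
  | nil => intro x; rfl
  | cons c w ih =>
    intro x
    rw [List.foldl_cons, List.reverse_cons, List.foldl_append, ih]
    exact act_invol μ hμ c x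

/-- Membership in the `Finset` of all colour words of length `m`. -/
theorem mem_words {m : ℕ} {g : List (Fin 3)} :
    g ∈ (Finset.univ : Finset (List.Vector (Fin 3) m)).image (fun v => v.toList) ↔ g.length = m := by
  constructor
  · intro h
    obtain ⟨v, -, rfl⟩ := Finset.mem_image.1 h
    exact v.toList_length
  · intro h
    exact Finset.mem_image.2 ⟨⟨g, h⟩, Finset.mem_univ _, rfl⟩

/-- Membership in the `Finset` of reduced continuations of the letter `c` of length `k`
(reduced words `g` of length `k` such that `c g` is reduced). -/
theorem mem_cont {k : ℕ} {c : Fin 3} {g : List (Fin 3)} :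
    g ∈ ((Finset.univ : Finset (List.Vector (Fin 3) k)).image (fun v => v.toList)).filter
        (fun g => List.IsChain (· ≠ ·) (c :: g)) ↔ g.length = k ∧ List.IsChain (· ≠ ·) (c :: g) := by
  rw [Finset.mem_filter, mem_words]

/-- **Counting reduced continuations**: exactly `2 ^ k` reduced words `g` of length `k` have `c g` reduced
(each letter avoids its predecessor). [folklore] -/
theorem card_cont : ∀ (k : ℕ) (c : Fin 3),
    (((Finset.univ : Finset (List.Vector (Fin 3) k)).image (fun v => v.toList)).filter
        (fun g => List.IsChain (· ≠ ·) (c :: g))).card = 2 ^ k := by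
  intro k
  induction k with
  | zero =>
    intro c
    rw [pow_zero, Finset.card_eq_one]
    refine ⟨[], ?_⟩
    ext g
    rw [mem_cont, Finset.mem_singleton, List.length_eq_zero_iff]
    constructor
    · exact fun h => h.1
    · rintro rfl
      exact ⟨rfl, List.isChain_singleton _⟩
  | succ k ih =>
    intro c
    have hdec : ((Finset.univ : Finset (List.Vector (Fin 3) (k + 1))).image (fun v => v.toList)).filter
        (fun g => List.IsChain (· ≠ ·) (c :: g)) =
        ((Finset.univ : Finset (Fin 3)).filter (fun d => d ≠ c)).biUnion (fun d =>
          (((Finset.univ : Finset (List.Vector (Fin 3) k)).image (fun v => v.toList)).filter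
            (fun g => List.IsChain (· ≠ ·) (d :: g))).image (List.cons d)) := by
      ext g
      rw [mem_cont, Finset.mem_biUnion]
      constructor
      · rintro ⟨hlen, hch⟩
        obtain ⟨d, g', rfl⟩ := List.exists_cons_of_ne_nil (List.ne_nil_of_length_eq_add_one hlen)
        rw [List.isChain_cons_cons] at hch
        refine ⟨d, Finset.mem_filter.2 ⟨Finset.mem_univ _, fun h => hch.1 h.symm⟩,
          Finset.mem_image.2 ⟨g', mem_cont.2 ⟨by simpa using hlen, hch.2⟩, rfl⟩⟩
      · rintro ⟨d, hd, hg⟩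
        obtain ⟨g', hg', rfl⟩ := Finset.mem_image.1 hg
        obtain ⟨hlen, hch⟩ := mem_cont.1 hg'
        refine ⟨by simp [hlen], List.isChain_cons_cons.2 ⟨?_, hch⟩⟩
        exact fun h => (Finset.mem_filter.1 hd).2 h.symm
    rw [hdec, Finset.card_biUnion]
    · have hc : ∀ d ∈ (Finset.univ : Finset (Fin 3)).filter (fun d => d ≠ c),
          ((((Finset.univ : Finset (List.Vector (Fin 3) k)).image (fun v => v.toList)).filter
            (fun g => List.IsChain (· ≠ ·) (d :: g))).image (List.cons d)).card = 2 ^ k := by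
        intro d _
        rw [Finset.card_image_of_injective _ List.cons_injective, ih d]
      rw [Finset.sum_congr rfl hc, Finset.sum_const, smul_eq_mul, Finset.filter_ne',
        Finset.card_erase_of_mem (Finset.mem_univ c), Finset.card_univ, Fintype.card_fin, pow_succ]
      ring
    · intro d _ d' _ hdd'
      simp only [Function.onFun]
      rw [Finset.disjoint_left]
      intro g hg hg'
      obtain ⟨x, -, rfl⟩ := Finset.mem_image.1 hg
      obtain ⟨y, -, hy⟩ := Finset.mem_image.1 hg'
      exact hdd' (List.cons_eq_cons.1 hy).1.symm

/-- **Cauchy–Schwarz / pigeonhole on the `c`-darts.**  The `n · 2^k` data (`a`, reduced `g` of length `k` with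
`c g` reduced) are mapped to `(a · g, (μ c a) · g) ∈ Fin n × Fin n`; at least `4^k − n·2^k` ordered pairs of
DISTINCT data collide, and a colliding pair `((a, g), (a', g'))` is recorded injectively as the triple `(a, g, g')`,
which has `g ≠ g'` and `(μ c a) · (g g'⁻¹) = μ c (a · (g g'⁻¹))`.  Hence
`4^k ≤ n·2^k + #{such triples}`. [this line, NOTES (15.1)] -/
theorem coll_lower (μ : Fin 3 → Equiv.Perm (Fin n)) (hμ : ∀ d, μ d * μ d = 1) (hn : 0 < n) (c : Fin 3)
    (k : ℕ) :
    4 ^ k ≤ n * 2 ^ k +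
      (((Finset.univ : Finset (Fin n)) ×ˢ
        ((((Finset.univ : Finset (List.Vector (Fin 3) k)).image (fun v => v.toList)).filter
            (fun g => List.IsChain (· ≠ ·) (c :: g))) ×ˢ
          (((Finset.univ : Finset (List.Vector (Fin 3) k)).image (fun v => v.toList)).filter
            (fun g => List.IsChain (· ≠ ·) (c :: g))))).filter
        (fun x => x.2.1 ≠ x.2.2 ∧
          (x.2.1 ++ x.2.2.reverse).foldl (fun v d => μ d v) (μ c x.1) =
            μ c ((x.2.1 ++ x.2.2.reverse).foldl (fun v d => μ d v) x.1))).card := by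
  classical
  -- the data set `D`, the map `φ`, its fibres
  set W : Finset (List (Fin 3)) := ((Finset.univ : Finset (List.Vector (Fin 3) k)).image
    (fun v => v.toList)).filter (fun g => List.IsChain (· ≠ ·) (c :: g)) with hW
  set D : Finset (Fin n × List (Fin 3)) := (Finset.univ : Finset (Fin n)) ×ˢ W with hD
  have hDcard : D.card = n * 2 ^ k := by
    rw [hD, Finset.card_product, Finset.card_univ, Fintype.card_fin, hW, card_cont k c]
  let φ : Fin n × List (Fin 3) → Fin n × Fin n := fun x =>
    (x.2.foldl (fun v d => μ d v) x.1, x.2.foldl (fun v d => μ d v) (μ c x.1))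
  set E : Finset ((Fin n × List (Fin 3)) × (Fin n × List (Fin 3))) :=
    (D ×ˢ D).filter (fun xy => φ xy.1 = φ xy.2) with hE
  -- (1) Σ_z |fibre z| = |D|
  have h1 : D.card = ∑ z : Fin n × Fin n, (D.filter (fun x => φ x = z)).card :=
    Finset.card_eq_sum_card_fiberwise (fun x _ => Finset.mem_univ (φ x))
  -- (2) Σ_z |fibre z|² = |E|
  have h2 : E.card = ∑ z : Fin n × Fin n, (D.filter (fun x => φ x = z)).card ^ 2 := by
    rw [Finset.card_eq_sum_card_fiberwise (f := fun xy => φ xy.1) (t := Finset.univ)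
      (fun xy _ => Finset.mem_univ _)]
    refine Finset.sum_congr rfl fun z _ => ?_
    have : E.filter (fun xy => φ xy.1 = z) = D.filter (fun x => φ x = z) ×ˢ D.filter (fun x => φ x = z) := by
      ext ⟨x, y⟩
      simp only [hE, Finset.mem_filter, Finset.mem_product]
      constructor
      · rintro ⟨⟨⟨hx, hy⟩, hxy⟩, hxz⟩
        exact ⟨⟨hx, hxz⟩, hy, by rw [← hxy, hxz]⟩
      · rintro ⟨⟨hx, hxz⟩, hy, hyz⟩
        exact ⟨⟨⟨hx, hy⟩, by rw [hxz, hyz]⟩, hxz⟩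
    rw [this, Finset.card_product, sq]
  -- (3) Cauchy–Schwarz
  have h3 : D.card ^ 2 ≤ (n * n) * E.card := by
    have := sq_sum_le_card_mul_sum_sq (s := (Finset.univ : Finset (Fin n × Fin n)))
      (f := fun z => (D.filter (fun x => φ x = z)).card)
    rw [← h1, ← h2, Finset.card_univ, Fintype.card_prod, Fintype.card_fin] at this
    exact this
  -- (4) |E| = |D| + |off-diagonal part|
  have h4 : E.card = D.card + (E.filter (fun xy => xy.1 ≠ xy.2)).card := by
    have hsplit := Finset.card_filter_add_card_filter_not (s := E) (fun xy => xy.1 = xy.2)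
    have hdiag : (E.filter (fun xy => xy.1 = xy.2)).card = D.card := by
      have : E.filter (fun xy => xy.1 = xy.2) = D.image (fun x => (x, x)) := by
        ext ⟨x, y⟩
        simp only [hE, Finset.mem_filter, Finset.mem_product, Finset.mem_image]
        constructor
        · rintro ⟨⟨⟨hx, -⟩, -⟩, rfl⟩
          exact ⟨x, hx, rfl⟩
        · rintro ⟨a, ha, h⟩
          obtain ⟨rfl, rfl⟩ := Prod.mk.inj h
          exact ⟨⟨⟨ha, ha⟩, rfl⟩, rfl⟩
      rw [this, Finset.card_image_of_injective _ (fun x y h => (Prod.mk.inj h).1)]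
    rw [hdiag] at hsplit
    exact hsplit.symm
  -- (5) the off-diagonal part injects into the triples
  have h5 : (E.filter (fun xy => xy.1 ≠ xy.2)).card ≤
      (((Finset.univ : Finset (Fin n)) ×ˢ (W ×ˢ W)).filter
        (fun x => x.2.1 ≠ x.2.2 ∧
          (x.2.1 ++ x.2.2.reverse).foldl (fun v d => μ d v) (μ c x.1) =
            μ c ((x.2.1 ++ x.2.2.reverse).foldl (fun v d => μ d v) x.1))).card := by
    refine Finset.card_le_card_of_injOn (fun xy => (xy.1.1, xy.1.2, xy.2.2)) ?_ ?_
    · intro xy hxy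
      obtain ⟨hxyE, hne⟩ := Finset.mem_filter.1 (Finset.mem_coe.1 hxy)
      obtain ⟨hxyD, hφ⟩ := Finset.mem_filter.1 hxyE
      obtain ⟨hx, hy⟩ := Finset.mem_product.1 hxyD
      obtain ⟨-, hg⟩ := Finset.mem_product.1 hx
      obtain ⟨-, hg'⟩ := Finset.mem_product.1 hy
      obtain ⟨hφ1, hφ2⟩ := Prod.mk.inj hφ
      refine Finset.mem_coe.2 (Finset.mem_filter.2 ⟨Finset.mem_product.2 ⟨Finset.mem_univ _,
        Finset.mem_product.2 ⟨hg, hg'⟩⟩, ?_, ?_⟩)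
      · show xy.1.2 ≠ xy.2.2
        intro hgg
        apply hne
        have ha : xy.1.1 = xy.2.1 := by
          apply foldl_injective μ xy.1.2
          simp only
          rw [hφ1, hgg]
        exact Prod.ext ha hgg
      · show (xy.1.2 ++ xy.2.2.reverse).foldl (fun v d => μ d v) (μ c xy.1.1) =
          μ c ((xy.1.2 ++ xy.2.2.reverse).foldl (fun v d => μ d v) xy.1.1)
        rw [List.foldl_append, List.foldl_append]
        change xy.2.2.reverse.foldl (fun v d => μ d v) (φ xy.1).2 =
          μ c (xy.2.2.reverse.foldl (fun v d => μ d v) (φ xy.1).1)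
        rw [hφ]
        change xy.2.2.reverse.foldl (fun v d => μ d v) (xy.2.2.foldl (fun v d => μ d v) (μ c xy.2.1)) =
          μ c (xy.2.2.reverse.foldl (fun v d => μ d v) (xy.2.2.foldl (fun v d => μ d v) xy.2.1))
        rw [foldl_act_reverse μ hμ, foldl_act_reverse μ hμ]
    · intro xy hxy xy' hxy' h
      obtain ⟨hxyE, -⟩ := Finset.mem_filter.1 (Finset.mem_coe.1 hxy)
      obtain ⟨-, hφ⟩ := Finset.mem_filter.1 hxyE
      obtain ⟨hxyE', -⟩ := Finset.mem_filter.1 (Finset.mem_coe.1 hxy')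
      obtain ⟨-, hφ'⟩ := Finset.mem_filter.1 hxyE'
      simp only [Prod.mk.injEq] at h
      obtain ⟨ha, hg, hg'⟩ := h
      have hφ1 := (Prod.mk.inj hφ).1
      have hφ1' := (Prod.mk.inj hφ').1
      have ha' : xy.2.1 = xy'.2.1 := by
        apply foldl_injective μ xy.2.2
        simp only
        rw [← hφ1, hg', ← hφ1', ha, hg]
      exact Prod.ext (Prod.ext ha hg) (Prod.ext ha' hg')
  -- assemble
  have key : (n * n) * 4 ^ k ≤ (n * n) * (n * 2 ^ k + (E.filter (fun xy => xy.1 ≠ xy.2)).card) := by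
    have e : (n * n) * 4 ^ k = D.card ^ 2 := by
      rw [hDcard, show (4 : ℕ) = 2 ^ 2 by norm_num, ← pow_mul]
      ring
    rw [e, ← hDcard, ← h4]
    exact h3
  have hnn : 0 < n * n := Nat.mul_pos hn hn
  exact (Nat.le_of_mul_le_mul_left key hnn).trans (Nat.add_le_add_left h5 _)


/-- **Registered form** (`stub_sameColourCollisions`, a `--supports` sub-goal of crux `stmt-MatrixMultiplication-10883`):
`coll_lower` fully quantified. -/
theorem stub_sameColourCollisions : ∀ (n k : ℕ) (μ : Fin 3 → Equiv.Perm (Fin n)) (c : Fin 3), (∀ d, μ d * μ d = 1) → 0 < n → 4 ^ k ≤ n * 2 ^ k + (((Finset.univ : Finset (Fin n)) ×ˢ ((((Finset.univ : Finset (List.Vector (Fin 3) k)).image (fun v => v.toList)).filter (fun g => List.IsChain (· ≠ ·) (c :: g))) ×ˢ (((Finset.univ : Finset (List.Vector (Fin 3) k)).image (fun v => v.toList)).filter (fun g => List.IsChain (· ≠ ·) (c :: g))))).filter (fun x => x.2.1 ≠ x.2.2 ∧ (x.2.1 ++ x.2.2.reverse).foldl (fun v d => μ d v) (μ c x.1)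 = μ c ((x.2.1 ++ x.2.2.reverse).foldl (fun v d => μ d v) x.1))).card :=
  fun _ k μ c hμ hn => coll_lower μ hμ hn c k

end Summit.MatrixMultiplication.MatrixMultiplication.Theorems.HyperoctahedralThreshold.SameColourSupply
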